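import Summits.AnomalousDissipation.AnomalousDissipation.Theses.VirtualDissipation
import Summits.AnomalousDissipation.AnomalousDissipation.Theorems.EnsembleRigidityDefs
import Summits.AnomalousDissipation.AnomalousDissipation.Theorems.EnsembleRigidityGPMeanBoundedFamilyStubSymmetricLimit
import Summits.AnomalousDissipation.AnomalousDissipation.Theorems.VirtualDissipationLightSteadyStatesGPStubSymmSteadyGalerkin
import Summits.AnomalousDissipation.AnomalousDissipation.Theorems.VirtualDissipationLightSteadyStatesGPStubSymmSteadyState
import Summits.AnomalousDissipation.AnomalousDissipation.Theorems.VirtualDissipationLightSteadyStatesGPStubShellOnePinning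
import Summits.AnomalousDissipation.AnomalousDissipation.Theorems.VirtualDissipationLightSteadyStatesGPStubEnergyWorkLaw
import Summits.AnomalousDissipation.AnomalousDissipation.Theorems.VirtualDissipationLightSteadyStatesGPStubLambModeTest
import Summits.AnomalousDissipation.AnomalousDissipation.Theorems.VirtualDissipationLightSteadyStatesGPStubAntiLaminar
import Literature.Analysis.FunctionSpaces.TorusTrigPoly

/-!
# Crux `LightSteadyStatesGP` (stmt-AnomalousDissipation-15151, route VirtualDissipation, rank 3) —
  skeleton of line `Sketch` (idea `crystallographic-pinning`) — lead 0 wave 1: S1–S6 LANDED; lead c1 (cycle 2):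
  kernel-checked reduction "S7 ⇔ crux ∩ Fix(G)" (`stub_lightSelectionGP_iff_conclusion`); open: S7 only

Work in the fixed space `V_G = Fix(G)` of the FULL stabiliser `G` (order 24) of the Galloway–Proctor
force `f_GP` (`IsGPSymmetric`, `gpForce`, `lambMode` of the landed `Theorems/EnsembleRigidityDefs`;
`gpForce` is the crux's inline sum of three Stokes modes by `rfl`, `gpForce_eq`).

Seven registered stubs, exactly one (S7) carrying the bet; `LightSteadyStatesGP_of` composes them BY NAME
and concludes the route decl
`Summit.AnomalousDissipation.AnomalousDissipation.Theses.VirtualDissipation.LightSteadyStatesGP`;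
sorries only inside `stub_*`.

* S1 `stub_symmSteadyGalerkinGP` — `G`-symmetric STATIONARY Galerkin approximations of `NS_ν(f_GP)`
  on the punctured frequency balls (Temam 1979 Ch. II Thm 1.2 (i) run inside `Fix(G)`: the acute-angle
  lemma `Brouwer.exists_zero_of_bilin_coercive` on the `G`-fixed subspace of the Galerkin phase space,
  which the Galerkin field preserves by the landed covariance `galerkinField_signedPerm`). Known theorem, L.
* S2 `stub_symmSteadyStateGP` — S1 ⇒ at every `ν > 0` a `G`-symmetric mean-zero CLASSICAL steady state
  `(u, p)` of `NS_ν(f_GP)` (compactness limit as in `exists_mem_energySpaceV_isSteadyWeakSolution`,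
  symmetry of the limit `ae_symm_of_tendsto`, Temam regularity `Temam1979_steadyWeakSolution_smooth_holds`,
  continuity upgrades a.e.-symmetry to symmetry, pressure `DriftClassical.exists_pressure`). Known, L.
* S3 `stub_shellOnePinningGP` — PINNING: the forcing-shell projection of a smooth solenoidal mean-zero
  `G`-symmetric field is `P₁u = (2/3)(f_GP, u) f_GP` (`Fix(G) ∩ shell 1 = ℝ f_GP`, the landed
  `stub_headPinned` applied to `P₁u`). M.
* S4 `stub_energyWorkLawGP` — S3 ⇒ for `G`-symmetric classical steady states: work = dissipation
  `(f_GP, u) = ν‖∇u‖²` and the ENERGY–WORK LAW `∫|P₁u|² = (2/3)(ν‖∇u‖²)²`. M.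
* S5 `stub_lambModeTestGP` — LAMB-MODE TEST for EVERY classical steady state (no symmetry):
  `∫⟪(u·∇)g, u⟫ = 8π²ν (u, g)`, `g = lambMode` (test the momentum equation with `g`: `(f_GP, g) = 0`,
  `Δg = −8π²g`, `∫⟪∇p, g⟫ = 0`, antisymmetry of `b(u,·,·)`). M.
* S6 `stub_antiLaminarGP` — S3 ⇒ S5 ⇒ ANTI-LAMINAR LAW: `∫|P₁u|² ≤ C (E_tail + ν²)` for every
  `G`-symmetric classical steady state, `E_tail = ∫|u|² − ∫|P₁u|²` (the Lamb-mode test is coercive on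
  shell 1 because `∫ f_GPᵀ(∇g)f_GP = −3π/2 ≠ 0`; Cauchy–Schwarz + AM-GM with explicit sup/L² bounds of `g`). L.
* S7 `stub_lightSelectionGP` — THE BET (the crux restricted to `Fix(G)`, structured by S2/S4/S6): along
  some `ν_j → 0` in `(0,1]` there are LIGHT (`∫|u|² ≤ 2`) `G`-symmetric classical steady states.
  Printed open in every form (Constantin–Tarfulea–Vicol 2013 p. 3: bounded sequences of stationary
  solutions of forced periodic NS); numerics: the primary `G`-symmetric branch is light and loud down to
  `ν_box = 0.0144` (`E_unit 0.86 → 1.02`, NumericsJ018975) with energy creep exponent ≈ −0.25.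

Composition: S1+S2 give symmetric existence; S3 feeds S4 and S6, S5 feeds S6; S7 fed with (S2, S4, S6)
gives light `G`-symmetric classical steady states along `ν_j → 0`; oddness (part of `IsGPSymmetric`)
gives the crux's mean-zero clause (`hasZeroMean_of_isGPSymmetric`, proved here); `gpForce` is the
crux's force by `rfl`.

Reduction (cycle 2, proved): `stub_lightSelectionGP_iff_conclusion` — because S2∘S1, S4∘S3, S6∘(S3,S5)
are theorems, S7 is EQUIVALENT to its conclusion (light `G`-symmetric classical steady states along some
`ν_j → 0`), and `LightSteadyStatesGP_of` is literally "that conclusion ⇒ crux" applied to it;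
`symmLightSeq_iff_frequently` — sequence-free form (light symmetric classical steady states at arbitrarily
small `ν > 0`). So the bet is exactly the crux with `G`-symmetric witnesses: no slack, crux-sized (CTV2013
p. 3; strategist census: no strategy short of the summit; Disproof.lean: `¬Crux ↔ HeavyBelow`, no method).
-/

noncomputable section

-- every `Summit.AnomalousDissipation.AnomalousDissipation.…` name repeats the summit = sub-problem segment (D-0017 layout)
set_option linter.dupNamespace false

namespace Summit.AnomalousDissipation.AnomalousDissipation.Theorems.VirtualDissipation.LightSteadyStatesGP

open MeasureTheory Filter Topology UnitAddTorus
open scoped InnerProductSpace ENNReal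
open Literature.Analysis.FunctionSpaces Literature.Analysis.FluidPDE
open Summit.AnomalousDissipation.AnomalousDissipation.Theorems.EnsembleRigidity

-- S1 `stub_symmSteadyGalerkinGP` LANDED (p162021): `…Theorems.VirtualDissipationLightSteadyStatesGPStubSymmSteadyGalerkin`.

-- S2 `stub_symmSteadyStateGP` LANDED (p161811): `…Theorems.VirtualDissipationLightSteadyStatesGPStubSymmSteadyState`.

-- S3 `stub_shellOnePinningGP` LANDED (p161559): `…Theorems.VirtualDissipationLightSteadyStatesGPStubShellOnePinning`.

-- S4 `stub_energyWorkLawGP` LANDED (p161283): `…Theorems.VirtualDissipationLightSteadyStatesGPStubEnergyWorkLaw`.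

-- S5 `stub_lambModeTestGP` LANDED (p161457): `…Theorems.VirtualDissipationLightSteadyStatesGPStubLambModeTest`.

-- S6 `stub_antiLaminarGP` LANDED (p161892): `…Theorems.VirtualDissipationLightSteadyStatesGPStubAntiLaminar`.

/-- **S7 `stub_lightSelectionGP`** — THE BET (the crux's content restricted to `Fix(G)`; printed open:
Constantin–Tarfulea–Vicol 2013, p. 3). GIVEN symmetric existence at every viscosity (conclusion of S2),
the work/energy–work laws (conclusion of S4) and the anti-laminar law (conclusion of S6) — which together
say that every `G`-symmetric steady state has `∫|u|² = (2/3)ε² + E_tail`, `ε = ν‖∇u‖² = (f_GP,u) ≤ √3`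
on light states, and that a HEAVY symmetric state must be TAIL-heavy (`E_tail ≥ (∫|u|² − Cν²)/(1+C)`) —
along SOME viscosities `ν_j ∈ (0,1]`, `ν_j → 0`, there is a `G`-symmetric classical steady state of
`NS_{ν_j}(f_GP)` of energy `≤ 2`. Why plausibly true: the primary `G`-symmetric branch (unique state at
`ν = 1` continued) is light and loud to `ν_box = 0.0144` (`E_unit 0.86 → 1.02`, `ε_unit ≈ 0.37` plateau,
NumericsJ018975; tail-dominated, `E_tail/E = 0.81` at `ν_box = 0.063`, kit j025614). Why it might fail:
every symmetric branch turns tail-heavy as `ν → 0` (energy creep exponent ≈ −0.25 not saturating;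
Galerkin toys K ≤ 4 turn heavy); no ν-uniform energy bound is known for any fixed 3-D force. -/
theorem stub_lightSelectionGP :
    (∀ ν : ℝ, 0 < ν → ∃ (u : UnitAddTorus (Fin 3) → EuclideanSpace ℝ (Fin 3)) (p : UnitAddTorus (Fin 3) → ℝ),
      Torus.IsClassicalNSSolutionOn Set.univ ν (fun _ => gpForce) (fun _ => u) (fun _ => p) ∧
      Torus.HasZeroMean u ∧ IsGPSymmetric u) →
    (∀ (ν : ℝ) (u : UnitAddTorus (Fin 3) → EuclideanSpace ℝ (Fin 3)) (p : UnitAddTorus (Fin 3) → ℝ),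
      0 < ν → Torus.IsClassicalNSSolutionOn Set.univ ν (fun _ => gpForce) (fun _ => u) (fun _ => p) →
      Torus.HasZeroMean u → IsGPSymmetric u →
      (∫ x, ⟪gpForce x, u x⟫_ℝ = ν * Torus.gradNormSq u) ∧
      ∫ x, ‖Torus.fourierTruncate 1 u x‖ ^ 2 = (2 : ℝ) / 3 * (ν * Torus.gradNormSq u) ^ 2) →
    (∃ C : ℝ, 0 < C ∧
      ∀ (ν : ℝ) (u : UnitAddTorus (Fin 3) → EuclideanSpace ℝ (Fin 3)) (p : UnitAddTorus (Fin 3) → ℝ),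
        Torus.IsClassicalNSSolutionOn Set.univ ν (fun _ => gpForce) (fun _ => u) (fun _ => p) →
        Torus.HasZeroMean u → IsGPSymmetric u →
        ∫ x, ‖Torus.fourierTruncate 1 u x‖ ^ 2 ≤
          C * ((∫ x, ‖u x‖ ^ 2) - (∫ x, ‖Torus.fourierTruncate 1 u x‖ ^ 2) + ν ^ 2)) →
    ∃ ν : ℕ → ℝ, (∀ j, 0 < ν j ∧ ν j ≤ 1) ∧ Tendsto ν atTop (𝓝 0) ∧
      ∀ j, ∃ (u : UnitAddTorus (Fin 3) → EuclideanSpace ℝ (Fin 3)) (p : UnitAddTorus (Fin 3) → ℝ),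
        Torus.IsClassicalNSSolutionOn Set.univ (ν j) (fun _ => gpForce) (fun _ => u) (fun _ => p) ∧
        IsGPSymmetric u ∧ ∫ x, ‖u x‖ ^ 2 ≤ 2 := by
  sorry

/-! ## Glue (proved) -/

/-- An odd integrable field on `T³` has zero mean (`x ↦ −x` preserves Haar measure); in particular every
`G`-symmetric smooth field does. [folklore] -/
theorem hasZeroMean_of_isGPSymmetric {u : UnitAddTorus (Fin 3) → EuclideanSpace ℝ (Fin 3)}
    (hsym : IsGPSymmetric u) : Torus.HasZeroMean u := by
  obtain ⟨-, hodd, -⟩ := hsym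
  have hneg : ∀ y, u (-y) = -u y := fun y => by
    ext i
    rw [hodd y i]
    rfl
  have hmp : MeasurePreserving (Neg.neg : UnitAddTorus (Fin 3) → UnitAddTorus (Fin 3)) volume volume :=
    GPMeanBoundedFamily.StubSymmetricLimit.measurePreserving_neg_torus
  have h1 : ∫ y, u (-y) = ∫ y, u y := hmp.integral_comp (MeasurableEquiv.neg _).measurableEmbedding u
  have h2 : ∫ y, u (-y) = -∫ y, u y := by
    simp_rw [hneg]
    exact integral_neg u
  show ∫ y, u y = 0
  have h3 : ∫ y, u y = -∫ y, u y := h1.symm.trans h2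
  have h4 : (2 : ℝ) • ∫ y, u y = 0 := by
    rw [two_smul]
    nth_rewrite 2 [h3]
    exact add_neg_cancel _
  exact (smul_eq_zero.1 h4).resolve_left two_ne_zero

/-! ## The bet is the crux restricted to `Fix(G)` (kernel-checked reduction; lead c1, cycle 2)

The three hypotheses of S7 are LANDED THEOREMS (S2∘S1 = p161811∘p162021, S4∘S3 = p161283∘p161559,
S6∘(S3,S5) = p161892∘(p161559,p161457)), so `stub_lightSelectionGP` is *equivalent* to its own conclusion —
"light `G`-symmetric classical steady states of `NS_ν(f_GP)` along SOME `ν_j → 0` in `(0,1]`" — and that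
conclusion implies the crux outright.  Hence S7 carries no slack a worker could exploit: it is the crux with
symmetric witnesses (printed open: Constantin–Tarfulea–Vicol 2013 p. 3), i.e. crux-sized. -/

/-- **S7 ⇔ its conclusion**: the hypotheses of `stub_lightSelectionGP` are the landed theorems
`stub_symmSteadyStateGP stub_symmSteadyGalerkinGP`, `stub_energyWorkLawGP stub_shellOnePinningGP` and
`stub_antiLaminarGP stub_shellOnePinningGP stub_lambModeTestGP`, so the registered bet is equivalent to
"light `G`-symmetric classical steady states along some `ν_j → 0`" — the crux in `Fix(G)`. [folklore] -/
theorem stub_lightSelectionGP_iff_conclusion :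
    ((∀ ν : ℝ, 0 < ν → ∃ (u : UnitAddTorus (Fin 3) → EuclideanSpace ℝ (Fin 3)) (p : UnitAddTorus (Fin 3) → ℝ),
      Torus.IsClassicalNSSolutionOn Set.univ ν (fun _ => gpForce) (fun _ => u) (fun _ => p) ∧
      Torus.HasZeroMean u ∧ IsGPSymmetric u) →
    (∀ (ν : ℝ) (u : UnitAddTorus (Fin 3) → EuclideanSpace ℝ (Fin 3)) (p : UnitAddTorus (Fin 3) → ℝ),
      0 < ν → Torus.IsClassicalNSSolutionOn Set.univ ν (fun _ => gpForce) (fun _ => u) (fun _ => p) →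
      Torus.HasZeroMean u → IsGPSymmetric u →
      (∫ x, ⟪gpForce x, u x⟫_ℝ = ν * Torus.gradNormSq u) ∧
      ∫ x, ‖Torus.fourierTruncate 1 u x‖ ^ 2 = (2 : ℝ) / 3 * (ν * Torus.gradNormSq u) ^ 2) →
    (∃ C : ℝ, 0 < C ∧
      ∀ (ν : ℝ) (u : UnitAddTorus (Fin 3) → EuclideanSpace ℝ (Fin 3)) (p : UnitAddTorus (Fin 3) → ℝ),
        Torus.IsClassicalNSSolutionOn Set.univ ν (fun _ => gpForce) (fun _ => u) (fun _ => p) →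
        Torus.HasZeroMean u → IsGPSymmetric u →
        ∫ x, ‖Torus.fourierTruncate 1 u x‖ ^ 2 ≤
          C * ((∫ x, ‖u x‖ ^ 2) - (∫ x, ‖Torus.fourierTruncate 1 u x‖ ^ 2) + ν ^ 2)) →
    ∃ ν : ℕ → ℝ, (∀ j, 0 < ν j ∧ ν j ≤ 1) ∧ Tendsto ν atTop (𝓝 0) ∧
      ∀ j, ∃ (u : UnitAddTorus (Fin 3) → EuclideanSpace ℝ (Fin 3)) (p : UnitAddTorus (Fin 3) → ℝ),
        Torus.IsClassicalNSSolutionOn Set.univ (ν j) (fun _ => gpForce) (fun _ => u) (fun _ => p) ∧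
        IsGPSymmetric u ∧ ∫ x, ‖u x‖ ^ 2 ≤ 2) ↔
    ∃ ν : ℕ → ℝ, (∀ j, 0 < ν j ∧ ν j ≤ 1) ∧ Tendsto ν atTop (𝓝 0) ∧
      ∀ j, ∃ (u : UnitAddTorus (Fin 3) → EuclideanSpace ℝ (Fin 3)) (p : UnitAddTorus (Fin 3) → ℝ),
        Torus.IsClassicalNSSolutionOn Set.univ (ν j) (fun _ => gpForce) (fun _ => u) (fun _ => p) ∧
        IsGPSymmetric u ∧ ∫ x, ‖u x‖ ^ 2 ≤ 2 :=
  ⟨fun h => h (stub_symmSteadyStateGP stub_symmSteadyGalerkinGP) (stub_energyWorkLawGP stub_shellOnePinningGP)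
      (stub_antiLaminarGP stub_shellOnePinningGP stub_lambModeTestGP),
    fun h _ _ _ => h⟩

/-- **Sequence-free form** of the bet's conclusion (the shape a continuation / recurrence argument delivers):
light `G`-symmetric classical steady states exist at arbitrarily small positive viscosity iff they exist along a
sequence `ν_j → 0` in `(0,1]`. [folklore] -/
theorem symmLightSeq_iff_frequently :
    (∃ ν : ℕ → ℝ, (∀ j, 0 < ν j ∧ ν j ≤ 1) ∧ Tendsto ν atTop (𝓝 0) ∧
      ∀ j, ∃ (u : UnitAddTorus (Fin 3) → EuclideanSpace ℝ (Fin 3)) (p : UnitAddTorus (Fin 3) → ℝ),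
        Torus.IsClassicalNSSolutionOn Set.univ (ν j) (fun _ => gpForce) (fun _ => u) (fun _ => p) ∧
        IsGPSymmetric u ∧ ∫ x, ‖u x‖ ^ 2 ≤ 2) ↔
    ∀ ν₀ : ℝ, 0 < ν₀ → ∃ ν : ℝ, 0 < ν ∧ ν < ν₀ ∧
      ∃ (u : UnitAddTorus (Fin 3) → EuclideanSpace ℝ (Fin 3)) (p : UnitAddTorus (Fin 3) → ℝ),
        Torus.IsClassicalNSSolutionOn Set.univ ν (fun _ => gpForce) (fun _ => u) (fun _ => p) ∧
        IsGPSymmetric u ∧ ∫ x, ‖u x‖ ^ 2 ≤ 2 := by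
  constructor
  · rintro ⟨ν, hν, hν0, hsel⟩ ν₀ hν₀
    obtain ⟨j, hj⟩ := ((tendsto_order.1 hν0).2 ν₀ hν₀).exists
    exact ⟨ν j, (hν j).1, hj, hsel j⟩
  · intro h
    choose ν hνpos hνlt hsel using fun j : ℕ => h (min 1 (1 / ((j : ℝ) + 1))) (by positivity)
    refine ⟨ν, fun j => ⟨hνpos j, (hνlt j).le.trans (min_le_left _ _)⟩, ?_, hsel⟩
    exact squeeze_zero (fun j => (hνpos j).le) (fun j => (hνlt j).le.trans (min_le_right _ _))
      tendsto_one_div_add_atTop_nhds_zero_nat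

/-! ## Composition -/

/-- **Composition** (kernel-checked modulo the seven `stub_*`; after cycle 2 the only `sorry` is S7): the landed
S1…S6 discharge S7's hypotheses inside `stub_lightSelectionGP_iff_conclusion` (each stub entering BY NAME), S7
`stub_lightSelectionGP` then yields light `G`-symmetric classical steady states along `ν_j → 0`; oddness gives the
mean-zero clause (`hasZeroMean_of_isGPSymmetric`) and `gpForce` is the crux's inline force by `rfl` (`gpForce_eq`).
Concludes `Summit.AnomalousDissipation.AnomalousDissipation.Theses.VirtualDissipation.LightSteadyStatesGP` BY NAME;
it is the ONLY declaration of this file whose type is the crux (the conditional forms "conclusion ⇒ crux" /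
"light symmetric states at arbitrarily small ν ⇒ crux" are this proof read with `symmLightSeq_iff_frequently`). -/
theorem LightSteadyStatesGP_of :
    Summit.AnomalousDissipation.AnomalousDissipation.Theses.VirtualDissipation.LightSteadyStatesGP := by
  obtain ⟨ν, hν, hν0, hsel⟩ := stub_lightSelectionGP_iff_conclusion.1 stub_lightSelectionGP
  choose u p hsol hsym hE using hsel
  refine ⟨ν, u, p, hν, hν0, fun j => ?_, fun j => hasZeroMean_of_isGPSymmetric (hsym j), hE⟩
  have h := hsol j
  rw [gpForce_eq] at h
  exact h

end Summit.AnomalousDissipation.AnomalousDissipation.Theorems.VirtualDissipation.LightSteadyStatesGP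

end
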